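import Literature.NumberTheory.EllipticCurves.BurungaleKobayashiNakamuraOta2026.RubinPadicLFunction
import Literature.NumberTheory.GaloisRepresentations.FrobeniusDensity
import Literature.NumberTheory.Automorphic.ChebotarevArtinRepHolds
import Literature.NumberTheory.GaloisRepresentations.IntegralGaloisActionProofs
import HarnessLib

set_option linter.dupNamespace false
set_option autoImplicit false

/-!
# Lemma Ξ, kernel side (I): the norm `‖r̂₁(γ) − 1‖` of the avatar of a character of `Γ`
# at a topological generator, from its FROBENIUS VALUES (clause (P5)/(F2) of the Rubin package)

Helper file for the K7r Value crux `EllipticUnitValueSevenOfGZK` (stmt-BirchSwinnertonDyer-19945),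
line `rubin-formula-zp` v4, registered stub `stub_rubinPackageSevenZp`
(`X12.O11.RamifiedCMRubinPackageAtZp W 7 (-11)`), clause (P5) = (F2):
`‖avatarValueAt R.r γ - 1‖ ^ 2 = p⁻¹` for the avatar `R.r` of the de Rham generator `R.ξ = ξ₁`
([BKNO] Def. 4.2 ff.), `γ` a topological generator of the anticyclotomic `ℤ_p`-extension `κ`.

We prove, for ANY number field `K : Type`, prime `p`, `ℤ_p`-extension `κ` with topological generator
`γ`, Hecke character `ξ` with `p`-adic avatar `r` (`IsPAdicAvatarOf ι ξ r`) factoring through `κ`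
(`FactorsThroughZp κ r`), and any real `c < 1`:

* if for all finite places `v` outside a finite set, `v ∤ p`, `ξ` is unramified at `v` and the
  `p`-adic value `y_v = ι⁻¹(ξ(ϖ_v)) ∈ ℚ̄_p ⊂ ℂ_p` satisfies `‖y_v − 1‖² ≤ c`, and
* at ONE such place `v₀` equality `‖y_{v₀} − 1‖² = c` holds,

then `‖avatarValueAt r γ − 1‖² = c` (`norm_avatarValueAt_sub_one_sq_eq`); the datum-level corollary
`RubinPadicLFunctionData.norm_avatarValueAt_sub_one_sq_eq` is clause (P5) with `c = p⁻¹`.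

So (P5) is reduced to two statements about the VALUES of `ξ₁ = φ(φ∘c)⁻¹` at unramified places
(for `K = ℚ(√−7)`, `p = 7`, `φ = ψ_E`: `ξ₁((α)) = α/ᾱ ≡ 1 (mod √−7)`, with `ord_𝔭(α/ᾱ − 1) = 1` at
`α = (1 + √−7)/2`) — the Galois/class-field-theory layer is discharged here.

Proof. (1) `σ ↦ r̂(σ) ∈ ℂ_p` is continuous (`continuous_avatarValueAt`). (2) At an arithmetic
Frobenius `σ` at `𝔓 ∣ v`, `v ∤ p` unramified for `ξ`, `r̂(σ) = y_v⁻¹` (the `1 × 1` characteristic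
polynomial, `avatarValueAt_eq_of_hasFrobCharpolyAt`), and `‖y⁻¹ − 1‖ = ‖y − 1‖` for `‖y − 1‖ < 1`.
(3) Chebotarev (tree theorem `chebotarev_artinRep_holds` ⇒ `absoluteGaloisGroup.frobenius_dense`): the
Frobenius elements outside `S` are dense in `Γ_K`, so every `r̂(σ)` lies in the closed set
`{‖z − 1‖² ≤ c}` (`forall_avatarValueAt_mem_of_frobenius`). (4) `r` factors through `κ : Γ_K ↠ ℤ_p`,
a quotient map (compact → Hausdorff), so `r̂ = g ∘ κ` with `g` continuous; `g(n) = r̂(γ)ⁿ` for `n ∈ ℕ`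
and `ℕ` is dense in `ℤ_p`, whence `‖r̂(σ) − 1‖ ≤ ‖r̂(γ) − 1‖` for every `σ` by the ultrametric
inequality `‖aⁿ − 1‖ ≤ ‖a − 1‖` (`norm_avatarValueAt_sub_one_le_of_isTopGenerator`). (5) Apply (4) to a
Frobenius at `v₀`.

References: [BKNO] A. Burungale, S. Kobayashi, K. Nakamura, K. Ota, arXiv:2608.06879 (2026),
Def. 4.2, Thm. 4.12; J.-P. Serre, *Abelian ℓ-adic representations* (1968), Ch. I §2.2 Cor. 2;
L. Washington, *Introduction to Cyclotomic Fields*, §13.1.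
-/

noncomputable section

open scoped Classical NNReal Topology
open NumberField IsDedekindDomain Field Polynomial
  Literature.NumberTheory.EllipticCurves
  Literature.NumberTheory.EllipticCurves.BurungaleKobayashiNakamuraOta2026
  Literature.NumberTheory.GaloisRepresentations

namespace Summit.BirchSwinnertonDyer.BirchSwinnertonDyer.Theorems.RamifiedSevenEllipticUnits

namespace LemmaXi

variable {p : ℕ} [hp : Fact p.Prime]

/-! ## §1 Ultrametric element lemmas in `ℂ_p` -/

/-- In `ℂ_p`: `‖x − 1‖ ≤ 1 ⇒ ‖x‖ ≤ 1` (ultrametric). [folklore] -/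
theorem norm_le_one_of_norm_sub_one_le_one {x : ℂ_[p]} (h : ‖x - 1‖ ≤ 1) : ‖x‖ ≤ 1 := by
  have := IsUltrametricDist.norm_add_le_max (x - 1) (1 : ℂ_[p])
  rw [sub_add_cancel, norm_one] at this
  exact this.trans (max_le h le_rfl)

/-- In `ℂ_p`: `‖y − 1‖ < 1 ⇒ ‖y⁻¹ − 1‖ = ‖y − 1‖`. [folklore] -/
theorem norm_inv_sub_one_eq {y : ℂ_[p]} (h : ‖y - 1‖ < 1) : ‖y⁻¹ - 1‖ = ‖y - 1‖ := by
  -- `‖y‖ = 1` (a principal unit; cf. `Rank1Residual.X11b.R1.norm_eq_one_of_norm_sub_one_lt`)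
  have hy1 : ‖y‖ = 1 := by
    have hne : ‖y - 1‖ ≠ ‖(1 : ℂ_[p])‖ := by rw [norm_one]; exact h.ne
    have := IsUltrametricDist.norm_add_eq_max_of_norm_ne_norm hne
    rw [sub_add_cancel, norm_one] at this
    rw [this]
    exact max_eq_right h.le
  have hy0 : y ≠ 0 := by
    intro h0; rw [h0, norm_zero] at hy1; exact zero_ne_one hy1
  have : y⁻¹ - 1 = y⁻¹ * (1 - y) := by field_simp
  rw [this, norm_mul, norm_inv, hy1, inv_one, one_mul, norm_sub_rev]

/-- In `ℂ_p`: `‖a − 1‖ ≤ 1 ⇒ ‖aⁿ − 1‖ ≤ ‖a − 1‖` (ultrametric: `aⁿ⁺¹ − 1 = a(aⁿ − 1) + (a − 1)`).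
[folklore] -/
theorem norm_pow_sub_one_le {a : ℂ_[p]} (h : ‖a - 1‖ ≤ 1) (n : ℕ) : ‖a ^ n - 1‖ ≤ ‖a - 1‖ := by
  have ha : ‖a‖ ≤ 1 := norm_le_one_of_norm_sub_one_le_one h
  induction n with
  | zero => simp
  | succ n ih =>
    have hsplit : a ^ (n + 1) - 1 = a * (a ^ n - 1) + (a - 1) := by ring
    rw [hsplit]
    refine (IsUltrametricDist.norm_add_le_max _ _).trans (max_le ?_ le_rfl)
    rw [norm_mul]
    calc ‖a‖ * ‖a ^ n - 1‖ ≤ 1 * ‖a - 1‖ := by gcongr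
      _ = ‖a - 1‖ := one_mul _

/-- `‖x‖² ≤ c < 1 ⇒ ‖x‖ < 1`. [folklore] -/
theorem norm_lt_one_of_sq_le {E : Type*} [SeminormedAddCommGroup E] {x : E} {c : ℝ}
    (h : ‖x‖ ^ 2 ≤ c) (hc : c < 1) : ‖x‖ < 1 := by
  have h1 : ‖x‖ ^ 2 < 1 := h.trans_lt hc
  nlinarith [norm_nonneg x]

/-! ## §2 The avatar as a continuous `ℂ_p`-valued function; Frobenius values -/

section Avatar

variable {K : Type*} [Field K]

/-- `σ ↦ r̂(σ) = det r(σ) ∈ ℂ_p` is continuous (`r` is a continuous homomorphism to `GL₁(ℚ̄_p)`,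
`det` and `ℚ̄_p ⊂ ℂ_p` are continuous). [cite: Castella2018, Thm. 3.1] -/
theorem continuous_avatarValueAt (r : FramedGaloisRep K (PadicAlgCl p) 1) :
    Continuous fun σ : absoluteGaloisGroup K ↦ avatarValueAt r σ := by
  have h1 : Continuous fun σ : absoluteGaloisGroup K ↦
      ((r σ : GL (Fin 1) (PadicAlgCl p)) : Matrix (Fin 1) (Fin 1) (PadicAlgCl p)).det :=
    (Units.continuous_val.comp r.continuous).matrix_det
  have h2 : (fun σ : absoluteGaloisGroup K ↦ avatarValueAt r σ) = fun σ ↦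
      ((((r σ : GL (Fin 1) (PadicAlgCl p)) : Matrix (Fin 1) (Fin 1) (PadicAlgCl p)).det :
        PadicAlgCl p) : ℂ_[p]) := by
    funext σ
    simp [avatarValueAt, Matrix.GeneralLinearGroup.val_det_apply]
  rw [h2]
  exact (UniformSpace.Completion.continuous_coe (PadicAlgCl p)).comp h1

/-- `r̂` is multiplicative: `r̂(σⁿ) = r̂(σ)ⁿ`. [cite: Castella2018, Thm. 3.1] -/
theorem avatarValueAt_pow (r : FramedGaloisRep K (PadicAlgCl p) 1) (σ : absoluteGaloisGroup K)
    (n : ℕ) : avatarValueAt r (σ ^ n) = avatarValueAt r σ ^ n := by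
  induction n with
  | zero => simp
  | succ n ih => rw [pow_succ, avatarValueAt_mul, ih, pow_succ]

/-- **The avatar at a Frobenius.** If `r` (rank one) has Frobenius characteristic polynomial `X − a`
at `v`, then `r̂(σ) = a` for every arithmetic Frobenius `σ` at a prime `𝔓 ∣ v` (a `1 × 1`
characteristic polynomial is `X − M₀₀ = X − det M`). [cite: SerreAbelianLadic1968, Ch. I §2.1] -/
theorem avatarValueAt_eq_of_hasFrobCharpolyAt {r : FramedGaloisRep K (PadicAlgCl p) 1}
    {v : HeightOneSpectrum (𝓞 K)} {a : PadicAlgCl p} (h : r.HasFrobCharpolyAt v (X - C a))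
    {𝔓 : Ideal (absIntegers (𝓞 K) K)} (h𝔓 : 𝔓 ∈ v.primesAbove) {σ : absoluteGaloisGroup K}
    (hσ : IsArithFrobAt (𝓞 K) σ 𝔓) : avatarValueAt r σ = ((a : PadicAlgCl p) : ℂ_[p]) := by
  have hchar := h 𝔓 h𝔓 σ hσ
  set M : Matrix (Fin 1) (Fin 1) (PadicAlgCl p) :=
    ((r σ : GL (Fin 1) (PadicAlgCl p)) : Matrix (Fin 1) (Fin 1) (PadicAlgCl p)) with hM
  have hcp : FramedRep.charpoly r σ = X - C (M 0 0) := by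
    rw [FramedRep.charpoly, ← hM, Matrix.charpoly, Matrix.det_fin_one, Matrix.charmatrix_apply_eq]
  have hM00 : M 0 0 = a := by
    have := hcp.symm.trans hchar
    exact Polynomial.C_inj.mp (sub_right_inj.mp this)
  have hdet : ((Matrix.GeneralLinearGroup.det (r σ) : (PadicAlgCl p)ˣ) : PadicAlgCl p) = a := by
    rw [Matrix.GeneralLinearGroup.val_det_apply, ← hM, Matrix.det_fin_one, hM00]
  rw [avatarValueAt, hdet]

end Avatar

/-! ## §3 Chebotarev: Frobenius values control all values -/

section Density

variable {K : Type} [Field K] [NumberField K]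

/-- **Density transfer.** If the avatar takes values in a CLOSED set `C ⊆ ℂ_p` at every arithmetic
Frobenius at every prime above every finite place outside a finite set `S`, then it takes values in
`C` everywhere: the Frobenius elements outside `S` are dense in `Γ_K` (Chebotarev, tree theorem
`absoluteGaloisGroup.frobenius_dense` fed with `chebotarev_artinRep_holds`) and `r̂` is continuous.
[cite: SerreAbelianLadic1968, Ch. I §2.2, Cor. 2 (a)] -/
theorem forall_avatarValueAt_mem_of_frobenius (r : FramedGaloisRep K (PadicAlgCl p) 1)
    {C : Set ℂ_[p]} (hC : IsClosed C) {S : Set (HeightOneSpectrum (𝓞 K))} (hS : S.Finite)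
    (h : ∀ v ∉ S, ∀ 𝔓 ∈ v.primesAbove, ∀ σ : absoluteGaloisGroup K,
      IsArithFrobAt (𝓞 K) σ 𝔓 → avatarValueAt r σ ∈ C)
    (σ : absoluteGaloisGroup K) : avatarValueAt r σ ∈ C := by
  have hD := absoluteGaloisGroup.frobenius_dense
    Literature.NumberTheory.Automorphic.chebotarev_artinRep_holds K S hS
  have hsub : {σ : absoluteGaloisGroup K | ∃ v ∉ S, ∃ 𝔓 ∈ v.primesAbove, IsArithFrobAt (𝓞 K) σ 𝔓} ⊆
      (fun σ ↦ avatarValueAt r σ) ⁻¹' C := by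
    rintro τ ⟨v, hv, 𝔓, h𝔓, hτ⟩
    exact h v hv 𝔓 h𝔓 τ hτ
  have hcl : IsClosed ((fun σ : absoluteGaloisGroup K ↦ avatarValueAt r σ) ⁻¹' C) :=
    hC.preimage (continuous_avatarValueAt r)
  have := hcl.closure_subset_iff.mpr hsub
  rw [hD.closure_eq] at this
  exact this (Set.mem_univ σ)

end Density

/-! ## §4 Characters of `Γ = Γ_K / ker κ ≅ ℤ_p`: the generator dominates -/

section Generator

variable {K : Type*} [Field K]

/-- If `r` factors through `κ` then `r̂` is constant on the fibres of `κ`. [cite: Castella2018, Thm. 3.1] -/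
theorem avatarValueAt_eq_of_apply_eq {κ : ZpExtension K p} {r : FramedGaloisRep K (PadicAlgCl p) 1}
    (hfac : FactorsThroughZp κ r) {σ τ : absoluteGaloisGroup K} (h : κ σ = κ τ) :
    avatarValueAt r σ = avatarValueAt r τ := by
  have h1 : κ (σ * τ⁻¹) = 1 := by
    rw [← ZpExtension.coe_toContinuousMonoidHom, map_mul, map_inv,
      ZpExtension.coe_toContinuousMonoidHom, h, mul_inv_cancel]
  have h2 : r (σ * τ⁻¹) = 1 := hfac _ h1
  have h3 : r σ = r τ := by
    rw [map_mul, map_inv, mul_inv_eq_one] at h2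
    exact h2
  simp [avatarValueAt, h3]

variable [CharZero K]

/-- **The generator dominates.** If `r` factors through the `ℤ_p`-extension `κ`, `γ` is a topological
generator (`κ γ = 1 ∈ ℤ_p`) and `‖r̂(γ) − 1‖ ≤ 1`, then `‖r̂(σ) − 1‖ ≤ ‖r̂(γ) − 1‖` for EVERY
`σ ∈ Γ_K`: `r̂` descends to a continuous `g : ℤ_p → ℂ_p` (`κ` is a quotient map, `Γ_K` compact,
`ℤ_p` Hausdorff) with `g(n) = r̂(γ)ⁿ` on the dense subset `ℕ ⊆ ℤ_p`, and `‖aⁿ − 1‖ ≤ ‖a − 1‖`.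
[cite: Washington1997, §13.1] -/
theorem norm_avatarValueAt_sub_one_le_of_isTopGenerator {κ : ZpExtension K p}
    {r : FramedGaloisRep K (PadicAlgCl p) 1} (hfac : FactorsThroughZp κ r)
    {γ : absoluteGaloisGroup K} (hγ : κ.IsTopGenerator γ) (hle : ‖avatarValueAt r γ - 1‖ ≤ 1)
    (σ : absoluteGaloisGroup K) : ‖avatarValueAt r σ - 1‖ ≤ ‖avatarValueAt r γ - 1‖ := by
  -- descend `r̂` along the surjection `κ`
  let g : Multiplicative ℤ_[p] → ℂ_[p] := fun x ↦
    avatarValueAt r (Function.surjInv κ.surjective x)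
  have hg : ∀ τ : absoluteGaloisGroup K, g (κ τ) = avatarValueAt r τ := by
    intro τ
    apply avatarValueAt_eq_of_apply_eq hfac
    exact Function.surjInv_eq κ.surjective (κ τ)
  have hgcomp : g ∘ (κ : absoluteGaloisGroup K → Multiplicative ℤ_[p]) =
      fun τ ↦ avatarValueAt r τ := funext hg
  -- `κ` is a quotient map, so `g` is continuous
  have hκc : Continuous (κ : absoluteGaloisGroup K → Multiplicative ℤ_[p]) :=
    κ.toContinuousMonoidHom.continuous
  have hq : Topology.IsQuotientMap (κ : absoluteGaloisGroup K → Multiplicative ℤ_[p]) :=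
    hκc.isClosedMap.isQuotientMap hκc κ.surjective
  have hgc : Continuous g := by
    rw [hq.continuous_iff, hgcomp]
    exact continuous_avatarValueAt r
  -- on `ℕ ⊆ ℤ_p`, `g(n) = r̂(γ)ⁿ`
  have hnat : ∀ n : ℕ, g (Multiplicative.ofAdd (n : ℤ_[p])) = avatarValueAt r γ ^ n := by
    intro n
    have hκn : κ (γ ^ n) = Multiplicative.ofAdd (n : ℤ_[p]) := by
      rw [← ZpExtension.coe_toContinuousMonoidHom, map_pow, ZpExtension.coe_toContinuousMonoidHom]
      rw [ZpExtension.IsTopGenerator] at hγ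
      rw [hγ, ← ofAdd_nsmul, nsmul_eq_mul, mul_one]
    rw [← hκn, hg, avatarValueAt_pow]
  -- the closed condition `‖g(x) − 1‖ ≤ ‖r̂(γ) − 1‖` holds on `ℕ`, hence on `ℤ_p`
  have hclosed : IsClosed {x : ℤ_[p] | ‖g (Multiplicative.ofAdd x) - 1‖ ≤ ‖avatarValueAt r γ - 1‖} := by
    have hc' : Continuous fun x : ℤ_[p] ↦ g (Multiplicative.ofAdd x) := hgc.comp continuous_ofAdd
    exact isClosed_le (continuous_norm.comp (hc'.sub continuous_const)) continuous_const
  have hrange : Set.range (Nat.cast : ℕ → ℤ_[p]) ⊆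
      {x : ℤ_[p] | ‖g (Multiplicative.ofAdd x) - 1‖ ≤ ‖avatarValueAt r γ - 1‖} := by
    rintro x ⟨n, rfl⟩
    simp only [Set.mem_setOf_eq, hnat n]
    exact norm_pow_sub_one_le hle n
  have hall : ∀ x : ℤ_[p], ‖g (Multiplicative.ofAdd x) - 1‖ ≤ ‖avatarValueAt r γ - 1‖ := by
    intro x
    have hx : x ∈ closure (Set.range (Nat.cast : ℕ → ℤ_[p])) := by
      rw [PadicInt.denseRange_natCast.closure_range]; exact Set.mem_univ x
    exact hclosed.closure_subset_iff.mpr hrange hx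
  have := hall (Multiplicative.toAdd (κ σ))
  rwa [ofAdd_toAdd, hg] at this

end Generator

/-! ## §5 Assembly: `‖r̂(γ) − 1‖² = c` from Frobenius values -/

section Main

variable {K : Type} [Field K] [NumberField K]

/-- **LEMMA Ξ (F2), value form.** `K : Type` a number field, `p` prime, `κ` a `ℤ_p`-extension with
topological generator `γ`, `ξ` a Hecke character with `p`-adic avatar `r` (w.r.t. `ι : ℚ̄_p ≃ ℂ`)
factoring through `κ`, `c < 1`. If outside a finite set of finite places every `v` has `v ∤ p`,
`ξ` unramified at `v` and `‖ι⁻¹(ξ(ϖ_v)) − 1‖² ≤ c` in `ℂ_p`, and at one such `v₀` equality holds, then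
`‖avatarValueAt r γ − 1‖² = c`. [cite: SerreAbelianLadic1968, Ch. I §2.2, Cor. 2 (a)]
[cite: BurungaleKobayashiNakamuraOta2026, Def. 4.2 (arXiv:2608.06879 p. 24) (shape of ξ₁, r₁)] -/
theorem norm_avatarValueAt_sub_one_sq_eq (κ : ZpExtension K p) {γ : absoluteGaloisGroup K}
    (hγ : κ.IsTopGenerator γ) (ι : PadicAlgCl p ≃+* ℂ) (ξ : HeckeCharacter K)
    (r : FramedGaloisRep K (PadicAlgCl p) 1) (hr : IsPAdicAvatarOf ι ξ r)
    (hfac : FactorsThroughZp κ r) {c : ℝ} (hc : c < 1)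
    (hall : ∃ S : Set (HeightOneSpectrum (𝓞 K)), S.Finite ∧ ∀ v ∉ S,
      ((p : ℕ) : 𝓞 K) ∉ v.asIdeal ∧ ξ.IsUnramifiedAt v ∧
        ‖((ι.symm (ξ.valueAtUniformizer v) : PadicAlgCl p) : ℂ_[p]) - 1‖ ^ 2 ≤ c)
    (hone : ∃ v : HeightOneSpectrum (𝓞 K), ((p : ℕ) : 𝓞 K) ∉ v.asIdeal ∧ ξ.IsUnramifiedAt v ∧
        ‖((ι.symm (ξ.valueAtUniformizer v) : PadicAlgCl p) : ℂ_[p]) - 1‖ ^ 2 = c) :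
    ‖avatarValueAt r γ - 1‖ ^ 2 = c := by
  -- the Frobenius value at an admissible place
  have hfrob : ∀ v : HeightOneSpectrum (𝓞 K), ((p : ℕ) : 𝓞 K) ∉ v.asIdeal → ξ.IsUnramifiedAt v →
      ‖((ι.symm (ξ.valueAtUniformizer v) : PadicAlgCl p) : ℂ_[p]) - 1‖ ^ 2 ≤ c →
      ∀ 𝔓 ∈ v.primesAbove, ∀ σ : absoluteGaloisGroup K, IsArithFrobAt (𝓞 K) σ 𝔓 →
        ‖avatarValueAt r σ - 1‖ =
          ‖((ι.symm (ξ.valueAtUniformizer v) : PadicAlgCl p) : ℂ_[p]) - 1‖ := by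
    intro v hpv hunr hle 𝔓 h𝔓 σ hσ
    obtain ⟨-, hchar⟩ := hr v hpv hunr
    rw [avatarValueAt_eq_of_hasFrobCharpolyAt hchar h𝔓 hσ, PadicComplex.coe_eq, map_inv₀,
      ← PadicComplex.coe_eq]
    exact norm_inv_sub_one_eq (norm_lt_one_of_sq_le hle hc)
  obtain ⟨S, hS, hS'⟩ := hall
  -- upper bound by density
  have hup : ‖avatarValueAt r γ - 1‖ ^ 2 ≤ c := by
    have hC : IsClosed {z : ℂ_[p] | ‖z - 1‖ ^ 2 ≤ c} :=
      isClosed_le ((continuous_norm.comp (continuous_id.sub continuous_const)).pow 2)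
        continuous_const
    have := forall_avatarValueAt_mem_of_frobenius r hC hS (fun v hv 𝔓 h𝔓 σ hσ ↦ by
      obtain ⟨hpv, hunr, hle⟩ := hS' v hv
      simp only [Set.mem_setOf_eq]
      rw [hfrob v hpv hunr hle 𝔓 h𝔓 σ hσ]
      exact hle) γ
    simpa only [Set.mem_setOf_eq] using this
  -- lower bound at `v₀`
  obtain ⟨v₀, hpv₀, hunr₀, heq₀⟩ := hone
  obtain ⟨𝔓₀, h𝔓₀⟩ := HeightOneSpectrum.primesAbove_nonempty v₀
  obtain ⟨σ₀, hσ₀⟩ := HeightOneSpectrum.exists_isArithFrobAt_of_mem_primesAbove_holds h𝔓₀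
  have hσ₀' : ‖avatarValueAt r σ₀ - 1‖ ^ 2 = c := by
    rw [hfrob v₀ hpv₀ hunr₀ heq₀.le 𝔓₀ h𝔓₀ σ₀ hσ₀, heq₀]
  have hle1 : ‖avatarValueAt r γ - 1‖ ≤ 1 := (norm_lt_one_of_sq_le hup hc).le
  have hdom := norm_avatarValueAt_sub_one_le_of_isTopGenerator hfac hγ hle1 σ₀
  have hlow : c ≤ ‖avatarValueAt r γ - 1‖ ^ 2 := by
    rw [← hσ₀']
    exact pow_le_pow_left₀ (norm_nonneg _) hdom 2
  exact le_antisymm hup hlow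

end Main

end LemmaXi

/-! ## §6 Clause (P5) of the Rubin package on the typed datum -/

section Datum

open LemmaXi

variable {W : WeierstrassCurve ℚ} [W.IsElliptic] {p : ℕ} [hp : Fact p.Prime]
  {K : Type} [Field K] [NumberField K] {c : K ≃ₐ[ℚ] K} {𝔭 : HeightOneSpectrum (𝓞 K)}
  {κ : ZpExtension K p} {γ : absoluteGaloisGroup K} {ι : PadicAlgCl p ≃+* ℂ} {φ : HeckeCharacter K}
  {Ω : ℂ} {𝓔 : AcDualExpSystem W p K 𝔭 κ ι} {D : EllipticUnitClassData W p K 𝔭 κ γ ι φ Ω 𝓔}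

/-- **Clause (P5) = (F2) of `RamifiedCMRubinPackageAtZp` from Frobenius values of `ξ₁`.** For a Rubin
`p`-adic `L`-function datum `R` ([BKNO] Def. 4.7: `R.ξ = ξ₁` a character of `Γ` with avatar `R.r`
factoring through `κ`, readings `r_avatar`, `r_factors`) over a topological generator `γ` of `κ`: if
outside a finite set every finite place `v ∤ p` has `ξ₁` unramified with `‖ι⁻¹(ξ₁(ϖ_v)) − 1‖² ≤ p⁻¹`
in `ℂ_p`, and one such place achieves equality, then `‖avatarValueAt R.r γ − 1‖² = p⁻¹`.
[cite: BurungaleKobayashiNakamuraOta2026, Def. 4.2 and Def. 4.7 (arXiv:2608.06879 pp. 24, 27) (claim; preprint; fields of the datum)] -/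
theorem RubinPadicLFunctionData.norm_avatarValueAt_sub_one_sq_eq [Fact (κ.IsTopGenerator γ)]
    (R : RubinPadicLFunctionData W p K c 𝔭 κ γ ι φ Ω 𝓔 D)
    (hall : ∃ S : Set (HeightOneSpectrum (𝓞 K)), S.Finite ∧ ∀ v ∉ S,
      ((p : ℕ) : 𝓞 K) ∉ v.asIdeal ∧ R.ξ.IsUnramifiedAt v ∧
        ‖((ι.symm (R.ξ.valueAtUniformizer v) : PadicAlgCl p) : ℂ_[p]) - 1‖ ^ 2 ≤ ((p : ℝ))⁻¹)
    (hone : ∃ v : HeightOneSpectrum (𝓞 K), ((p : ℕ) : 𝓞 K) ∉ v.asIdeal ∧ R.ξ.IsUnramifiedAt v ∧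
        ‖((ι.symm (R.ξ.valueAtUniformizer v) : PadicAlgCl p) : ℂ_[p]) - 1‖ ^ 2 = ((p : ℝ))⁻¹) :
    ‖avatarValueAt R.r γ - 1‖ ^ 2 = ((p : ℝ))⁻¹ :=
  LemmaXi.norm_avatarValueAt_sub_one_sq_eq κ (Fact.out : κ.IsTopGenerator γ) ι R.ξ R.r R.r_avatar
    R.r_factors (inv_lt_one_of_one_lt₀ (by exact_mod_cast hp.out.one_lt)) hall hone

end Datum

end Summit.BirchSwinnertonDyer.BirchSwinnertonDyer.Theorems.RamifiedSevenEllipticUnits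

end
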